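import Summits.ResolutionOfSingularities.ResolutionOfSingularities.Theorems.HomologicalConductorNoZenoDim2RegularCentre
import Summits.ResolutionOfSingularities.ResolutionOfSingularities.Theorems.SyzygyFlatteningHigherRankTerminationLocAt
import Summits.ResolutionOfSingularities.ResolutionOfSingularities.Theorems.HomologicalConductorNoZenoIffKernel
import Literature.RingTheory.KrullDimension.AffineCatenary
import HarnessLib

/-!
# Kill test `SurfaceTermination` (stmt-ResolutionOfSingularities-16488): LEMMA E in tower form —
# an initial pair with transcendental ratio makes the next stage of the `ca`-tower regular

Route `ResolutionOfSingularities/HomologicalConductor`; support item `SurfaceTermination`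
(kill test K4.4-s, residual (D-s)); OURS (cell res-hironaka, seat res-L0-w44-lead-1 gen 4), nothing here
is a statement of the manuscript under review; AI-written, weaker than expert review.

`isRegularLocalRing_tower_succ_of_initialPair`: in transcendence degree two, if the stage
`T_m := tower O A m` carries two elements `g₀, g₁ ∈ ca(T_m)` with `g₀` of MINIMAL `O`-value on
`ca(T_m)` and the ratio `s = g₁/g₀` residually TRANSCENDENTAL over `k` (every non-zero polynomial in
`s` is an `O`-unit), then `T_(m+1) = loc O (nrm (chart O T_m))` is a REGULAR local ring — the centre of
`O` on the normalised blow-up of `ca(T_m)` is a curve (paper memo `K44S-NONRATIONAL.md` §1, LEMMA E,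
direction ⟸). Proof: `s ∈ chart O T_m ⊆ T_(m+1)` and `k[s] ∖ 0 ⊆ T_(m+1)ˣ` (`T_(m+1)` is the
localisation at the centre and inverts `O`-units); `T_(m+1)` is essentially of finite type over `k`,
so it is the localisation of a finitely generated `k`-subalgebra `C ∋ s` at the prime `𝔮 = 𝔪 ∩ C`;
`C ⧸ 𝔮` contains the transcendental `s̄`, hence `dim (C ⧸ 𝔮) ≥ 1`, while `dim C ≤ tr.deg_k K = 2`,
so the dimension formula for affine domains (`height 𝔮 + dim C/𝔮 = dim C`, Matsumura Thm 5.6) gives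
`dim T_(m+1) = height 𝔮 ≤ 1`; `T_(m+1)` is not a field (`O ≠ K`), so it is a one-dimensional normal
noetherian local domain, i.e. a DVR, i.e. regular.

Neighbour in the tree: `SurfaceTermination.Regimes.exists_regular_of_residually_transcendental_mem_tower`
(`Theorems/HomologicalConductorSurfaceTerminationResidualCriterion.lean`: a residually transcendental
element IN a stage ⇒ that stage or the next is regular, via `k(t) ⊆ T_m` and Krull–Akizuki, `CharP k p`).
The present file is the INITIAL-PAIR form of LEMMA E (the hypothesis lives on `ca(T_m)`, as in the
kill-test skeleton's residual stub), with the sharper conclusion «`T_(m+1)` itself is regular» (normality of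
the stage instead of Krull–Akizuki), no characteristic hypothesis, and a dimension bound through an affine
model and the catenary formula (`ringKrullDim_le_one_of_transcendental_units`).

References: Matsumura, *Commutative Ring Theory*, Thm 5.6 (dimension formula), Thm 11.2 (normal of
dimension one ⇒ DVR) [`Matsumura1987`].
-/

noncomputable section

-- single-problem summit: the doubled namespace component `ResolutionOfSingularities` is forced
set_option linter.dupNamespace false

namespace Summit.ResolutionOfSingularities.ResolutionOfSingularities.Theorems.SurfaceTermination

open IsLocalRing Summit.ResolutionOfSingularities.ResolutionOfSingularities.Theses.HomologicalConductor
open Summit.ResolutionOfSingularities.ResolutionOfSingularities.Theorems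
open Summit.ResolutionOfSingularities.ResolutionOfSingularities.Theorems.NoZeno.Birth
open Literature.AlgebraicGeometry.Resolution

variable {k K : Type} [Field k] [Field K] [Algebra k K]

/-! ## Step 1: a one-dimensional normal noetherian local domain is regular -/

/-- A noetherian, integrally closed, local domain of Krull dimension one is a regular local ring
(it is a DVR: its non-zero primes are maximal, so it is a principal ideal ring, Matsumura Thm 11.2).
[cite: Matsumura1987, Thm. 11.2] -/
theorem isRegularLocalRing_of_isIntegrallyClosed_of_ringKrullDim_eq_one (R : Type*) [CommRing R]
    [IsDomain R] [IsNoetherianRing R] [IsLocalRing R] [IsIntegrallyClosed R]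
    (hdim : ringKrullDim R = 1) : IsRegularLocalRing R := by
  have hKD : Ring.KrullDimLE 1 R := Ring.krullDimLE_iff.mpr (by rw [Nat.cast_one]; exact hdim.le)
  have huniq : ∀ P : Ideal R, P ≠ ⊥ → P.IsPrime → P = maximalIdeal R := fun P hP0 hPp =>
    IsLocalRing.eq_maximalIdeal ((Ring.krullDimLE_one_iff_of_noZeroDivisors.mp hKD) P hP0 hPp)
  have h4 : IsIntegrallyClosed R ∧ ∀ P : Ideal R, P ≠ ⊥ → P.IsPrime → P = maximalIdeal R :=
    ⟨inferInstance, huniq⟩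
  haveI : IsPrincipalIdealRing R :=
    ((tfae_of_isNoetherianRing_of_isLocalRing_of_isDomain R).out 3 0).mp h4
  haveI hdvr : IsDiscreteValuationRing R := by
    refine IsDiscreteValuationRing.mk ?_
    intro h
    have h0 : ringKrullDim R = 0 :=
      ringKrullDim_eq_zero_of_isField ((IsLocalRing.isField_iff_maximalIdeal_eq).mpr h)
    rw [hdim] at h0
    exact one_ne_zero h0
  infer_instance

/-! ## Step 2: a residually transcendental unit bounds the dimension of an essentially-of-finite-type
local subalgebra of a function field of transcendence degree two -/

/-- Let `T ⊆ K` be a local `k`-subalgebra, essentially of finite type over `k`, of a field `K` with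
`tr.deg_k K = 2`, containing an element `s` such that every NON-ZERO polynomial in `s` is a unit of `T`
(«the residue of `s` is transcendental over `k`»). Then `dim T ≤ 1`: `T = C_𝔮` for a finitely generated
`C ∋ s`, and the dimension formula for the affine domain `C` reads `height 𝔮 + dim C/𝔮 = dim C ≤ 2` with
`dim C/𝔮 ≥ 1` (`s̄` is transcendental). [cite: Matsumura1987, Thm. 5.6] -/
theorem ringKrullDim_le_one_of_transcendental_units (T : Subalgebra k K) [IsLocalRing ↥T]
    (hE : Algebra.EssFiniteType k ↥T) (htr : Algebra.trdeg k K = 2) (s : K) (hs : s ∈ T)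
    (hunit : ∀ f : Polynomial k, f ≠ 0 → IsUnit (Polynomial.aeval (⟨s, hs⟩ : ↥T) f)) :
    ringKrullDim ↥T ≤ 1 := by
  classical
  -- a finitely generated model `C ∋ s` with `T = C_𝔮`
  obtain ⟨σ, hσ⟩ := hE.cond
  set σ' : Finset ↥T := insert ⟨s, hs⟩ σ with hσ'
  set C : Subalgebra k ↥T := Algebra.adjoin k (σ' : Set ↥T) with hC
  have hCC : Algebra.adjoin k (σ : Set ↥T) ≤ C :=
    Algebra.adjoin_mono (by rw [hσ']; exact_mod_cast Finset.subset_insert _ _)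
  have hloc : IsLocalization ((IsUnit.submonoid ↥T).comap (algebraMap ↥C ↥T)) ↥T := by
    rw [hC, Algebra.essFiniteType_cond_iff]
    intro t
    obtain ⟨u, hu, hunit', hmem⟩ := (Algebra.essFiniteType_cond_iff k (↥T) σ).mp hσ t
    exact ⟨u, hCC hu, hunit', hCC hmem⟩
  set 𝔮 : Ideal ↥C := (maximalIdeal ↥T).comap (algebraMap ↥C ↥T) with h𝔮
  haveI h𝔮p : 𝔮.IsPrime := Ideal.IsPrime.comap _
  have hsub : (IsUnit.submonoid ↥T).comap (algebraMap ↥C ↥T) = 𝔮.primeCompl := by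
    ext x
    simp only [Submonoid.mem_comap, IsUnit.mem_submonoid_iff, Ideal.primeCompl, h𝔮,
      Submonoid.mem_mk, Subsemigroup.mem_mk, Set.mem_compl_iff, SetLike.mem_coe, Ideal.mem_comap]
    exact (IsLocalRing.notMem_maximalIdeal).symm
  haveI : IsLocalization.AtPrime ↥T 𝔮 := by
    rw [IsLocalization.AtPrime, ← hsub]
    exact hloc
  have hdimT : ringKrullDim ↥T = 𝔮.height := IsLocalization.AtPrime.ringKrullDim_eq_height 𝔮 ↥T
  -- `C` is an affine domain of dimension ≤ 2
  haveI : Algebra.FiniteType k ↥C :=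
    (Subalgebra.fg_iff_finiteType C).mp (by rw [hC]; exact Subalgebra.fg_adjoin_finset _)
  obtain ⟨s₁, hdimC, htrC⟩ :=
    Literature.RingTheory.KrullDimension.exists_ringKrullDim_eq_and_trdeg_eq k ↥C
  have hs₁ : s₁ ≤ 2 := by
    have h1 : Algebra.trdeg k ↥C ≤ Algebra.trdeg k K :=
      trdeg_le_of_injective (T.val.comp C.val)
        (Subtype.val_injective.comp Subtype.val_injective)
    rw [htrC, htr] at h1
    exact_mod_cast h1
  -- `C ⧸ 𝔮` is an affine domain of dimension ≥ 1: the class of `s` is transcendental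
  have hsC : (⟨s, hs⟩ : ↥T) ∈ C := Algebra.subset_adjoin (by rw [hσ']; exact Finset.mem_insert_self _ _)
  obtain ⟨s₂, hdimQ, htrQ⟩ :=
    Literature.RingTheory.KrullDimension.exists_ringKrullDim_eq_and_trdeg_eq k (↥C ⧸ 𝔮)
  have hs₂ : 1 ≤ s₂ := by
    have htrans : Transcendental k (Ideal.Quotient.mk 𝔮 (⟨⟨s, hs⟩, hsC⟩ : ↥C)) := by
      rw [transcendental_iff]
      intro f hf
      by_contra hf0
      have h1 : Polynomial.aeval (⟨⟨s, hs⟩, hsC⟩ : ↥C) f ∈ 𝔮 := by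
        rw [← Ideal.Quotient.eq_zero_iff_mem, ← Ideal.Quotient.mkₐ_eq_mk k, ← Polynomial.aeval_algHom_apply]
        exact hf
      rw [h𝔮, Ideal.mem_comap] at h1
      have h2 : algebraMap ↥C ↥T (Polynomial.aeval (⟨⟨s, hs⟩, hsC⟩ : ↥C) f) =
          Polynomial.aeval (⟨s, hs⟩ : ↥T) f := by
        change C.val (Polynomial.aeval (⟨⟨s, hs⟩, hsC⟩ : ↥C) f) = _
        rw [← Polynomial.aeval_algHom_apply]
        rfl
      rw [h2] at h1
      exact (IsLocalRing.notMem_maximalIdeal.mpr (hunit f hf0)) h1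
    have hai : AlgebraicIndependent k ![Ideal.Quotient.mk 𝔮 (⟨⟨s, hs⟩, hsC⟩ : ↥C)] :=
      algebraicIndependent_iff_transcendental.mpr htrans
    have h3 := hai.cardinalMk_le_trdeg
    rw [htrQ] at h3
    simp only [Cardinal.mk_fintype, Fintype.card_unique, Nat.cast_one] at h3
    exact_mod_cast h3
  -- the dimension formula `dim C/𝔮 + height 𝔮 = dim C`
  have hcat := Literature.RingTheory.KrullDimension.ringKrullDim_quotient_add_height k 𝔮
  rw [hdimQ, hdimC] at hcat
  have hfin : 𝔮.height ≠ ⊤ := by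
    have hle := Ideal.height_le_ringKrullDim_of_ne_top (Ideal.IsPrime.ne_top h𝔮p)
    rw [hdimC] at hle
    have hle' : 𝔮.height ≤ s₁ := by exact_mod_cast hle
    exact ne_top_of_le_ne_top (ENat.coe_ne_top s₁) hle'
  obtain ⟨n, hn⟩ := ENat.ne_top_iff_exists.mp hfin
  rw [← hn] at hcat hdimT
  have hsum : s₂ + n = s₁ := by exact_mod_cast hcat
  rw [hdimT]
  have hn1 : n ≤ 1 := by omega
  exact_mod_cast hn1

/-! ## Step 3: LEMMA E in tower form -/

/-- **LEMMA E (tower form, transcendence degree two).** Let `A ⊆ O` be the route's data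
(`k ⊆ O ≠ K`, `A` finitely generated with `Frac A = K`, `tr.deg_k K = 2`) and `T_m := tower O A m` a stage
of the canonical normalised `ca`-tower. If `g₀, g₁ ∈ ca(T_m)` with `g₀ ≠ 0` of MINIMAL `O`-value on `ca(T_m)`
(`c·g₀⁻¹ ∈ O` for all `c ∈ ca(T_m)`) and the ratio `g₁·g₀⁻¹` is RESIDUALLY TRANSCENDENTAL over `k` (no
non-zero polynomial in it has positive `O`-value), then the next stage `T_(m+1)` is a regular local ring
(indeed a DVR: the centre of `O` on the normalised blow-up of `ca(T_m)` is a curve). Proof: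
`g₁·g₀⁻¹ ∈ chart O T_m ⊆ T_(m+1)`, which inverts `O`-units, so `ringKrullDim_le_one_of_transcendental_units`
gives `dim T_(m+1) ≤ 1`; `T_(m+1)` is not a field (`O ≠ K`, `Frac A = K`), normal (a localised normalisation)
and noetherian, hence regular (`isRegularLocalRing_of_isIntegrallyClosed_of_ringKrullDim_eq_one`).
[cite: Matsumura1987, Thm. 11.2] -/
theorem isRegularLocalRing_tower_succ_of_initialPair (O : ValuationSubring K) (A : Subalgebra k K)
    (hk : ∀ c : k, algebraMap k K c ∈ O) (hA : A.FG) (hfr : IsFractionRing ↥A K)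
    (hAO : A.toSubring ≤ O.toSubring) (hO : O ≠ ⊤) (htr : Algebra.trdeg k K = 2) (m : ℕ)
    (g₀ g₁ : K) (hg₀ : g₀ ∈ ca (tower O A m)) (hg₁ : g₁ ∈ ca (tower O A m)) (hg₀0 : g₀ ≠ 0)
    (hmin : ∀ c ∈ ca (tower O A m), c * g₀⁻¹ ∈ O)
    (htrans : ∀ f : Polynomial k, f ≠ 0 → ¬ O.valuation (Polynomial.aeval (g₁ * g₀⁻¹) f) < 1) :
    IsRegularLocalRing ↥(tower O A (m + 1)) := by
  haveI := hfr
  -- the stage `T' := T_(m+1)` and its standing properties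
  obtain ⟨hAT, hTO, hE⟩ := tn_tower_invariant O A hk hA hfr hAO (m + 1)
  haveI : IsNoetherianRing ↥(tower O A (m + 1)) := stub_towerNoetherian k K O A hk hA hfr hAO (m + 1)
  haveI : IsIntegrallyClosed ↥(tower O A (m + 1)) := d2rc_isIntegrallyClosed_tower_succ O A hk hA hfr hAO m
  obtain ⟨B, hBO, hTB⟩ := exists_tower_eq_loc O A hk hAO (m + 1)
  have hTB' : tower O A (m + 1) = SyzygyFlattening.locAt O B := by rw [hTB, loc_eq_locAt]
  haveI : IsLocalRing ↥(tower O A (m + 1)) := by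
    rw [hTB']
    exact SyzygyFlattening.isLocalRing_locAt O B hBO
  -- `s := g₁ g₀⁻¹` lies in the chart, hence in `T'`
  set s : K := g₁ * g₀⁻¹ with hs_def
  have hs_chart : s ∈ chart O (tower O A m) :=
    Algebra.subset_adjoin (Or.inr ⟨g₁, hg₁, g₀, hg₀, hg₀0, hmin, rfl⟩)
  have hsT : s ∈ tower O A (m + 1) := by
    rw [tower_succ]
    exact SyzygyFlattening.self_le_locAt O _ (SyzygyFlattening.self_le_nrm _ hs_chart)
  -- every non-zero polynomial in `s` is a unit of `T'`
  have hunit : ∀ f : Polynomial k, f ≠ 0 →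
      IsUnit (Polynomial.aeval (⟨s, hsT⟩ : ↥(tower O A (m + 1))) f) := by
    intro f hf
    set y : ↥(tower O A (m + 1)) := Polynomial.aeval (⟨s, hsT⟩ : ↥(tower O A (m + 1))) f with hy
    have hyK : (y : K) = Polynomial.aeval s f := by
      simp [hy]
    have hyO : (y : K) ∈ O := hTO (Subalgebra.mem_toSubring.mpr y.2)
    have hv : O.valuation (y : K) = 1 := by
      rcases (O.valuation_le_one ⟨(y : K), hyO⟩).lt_or_eq with hlt | heq
      · exact absurd hlt (by rw [hyK]; exact htrans f hf)
      · exact heq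
    have hy0 : (y : K) ≠ 0 := by
      intro h0
      rw [h0, map_zero] at hv
      exact zero_ne_one hv
    have hyinvT : (y : K)⁻¹ ∈ tower O A (m + 1) := by
      have hy' : (y : K) ∈ SyzygyFlattening.locAt O B := hTB'.le y.2
      exact hTB'.symm.le (SyzygyFlattening.inv_mem_locAt O B hBO hy' hv)
    exact ⟨⟨y, ⟨(y : K)⁻¹, hyinvT⟩, Subtype.ext (mul_inv_cancel₀ hy0),
      Subtype.ext (inv_mul_cancel₀ hy0)⟩, rfl⟩
  -- `dim T' ≤ 1`
  have hle : ringKrullDim ↥(tower O A (m + 1)) ≤ 1 :=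
    ringKrullDim_le_one_of_transcendental_units (tower O A (m + 1)) hE htr s hsT hunit
  -- `T'` is not a field: its maximal ideal is non-zero (`O ≠ K`)
  have hne : maximalIdeal ↥(tower O A (m + 1)) ≠ ⊥ := by
    intro hbot
    obtain ⟨y, -, hyO⟩ := SetLike.exists_of_lt hO.lt_top
    obtain ⟨a, b, hb, hab⟩ := IsFractionRing.div_surjective (A := ↥A) y
    have hb0 : (b : K) ≠ 0 := fun h => nonZeroDivisors.ne_zero hb (Subtype.ext h)
    have hbT : (b : K) ∈ tower O A (m + 1) := hAT b.2
    have hbunit : IsUnit (⟨(b : K), hbT⟩ : ↥(tower O A (m + 1))) := by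
      by_contra hnu
      have hmem : (⟨(b : K), hbT⟩ : ↥(tower O A (m + 1))) ∈ maximalIdeal ↥(tower O A (m + 1)) :=
        (IsLocalRing.mem_maximalIdeal _).mpr hnu
      rw [hbot, Ideal.mem_bot] at hmem
      exact hb0 (congrArg Subtype.val hmem)
    obtain ⟨u, hu⟩ := hbunit
    have hinv : (b : K)⁻¹ = ((u⁻¹ : (↥(tower O A (m + 1)))ˣ) : ↥(tower O A (m + 1))) := by
      have h1 : ((u : ↥(tower O A (m + 1))) : K) * ((u⁻¹ : (↥(tower O A (m + 1)))ˣ) :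
          ↥(tower O A (m + 1))) = 1 := by
        rw [← Subalgebra.coe_mul, Units.mul_inv, Subalgebra.coe_one]
      rw [hu] at h1
      exact (eq_inv_of_mul_eq_one_right h1).symm
    have hbinvO : (b : K)⁻¹ ∈ O := by
      rw [hinv]
      exact hTO (Subalgebra.mem_toSubring.mpr (SetLike.coe_mem _))
    apply hyO
    rw [← hab, div_eq_mul_inv]
    exact O.mul_mem _ _ (hTO (Subalgebra.mem_toSubring.mpr (hAT a.2))) hbinvO
  -- hence `dim T' = 1`
  have hge : (1 : WithBot ℕ∞) ≤ ringKrullDim ↥(tower O A (m + 1)) := by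
    have h0 : (maximalIdeal ↥(tower O A (m + 1))).height ≠ 0 :=
      fun h => hne (Ideal.height_eq_zero_iff_eq_bot.mp h)
    have h1 : (1 : ℕ∞) ≤ (maximalIdeal ↥(tower O A (m + 1))).height := Order.one_le_iff_ne_zero.mpr h0
    have h2 := Ideal.height_le_ringKrullDim_of_ne_top
      (Ideal.IsPrime.ne_top (inferInstance : (maximalIdeal ↥(tower O A (m + 1))).IsPrime))
    exact le_trans (by exact_mod_cast h1) h2
  have hdim : ringKrullDim ↥(tower O A (m + 1)) = 1 := le_antisymm hle hge
  exact isRegularLocalRing_of_isIntegrallyClosed_of_ringKrullDim_eq_one _ hdim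

end Summit.ResolutionOfSingularities.ResolutionOfSingularities.Theorems.SurfaceTermination

end
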